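import Mathlib.RingTheory.Nilpotent.Exp
import Mathlib.Algebra.Polynomial.Inductions
import Mathlib.Algebra.Polynomial.Roots
import Mathlib.LinearAlgebra.Dual.Lemmas
import Literature.AlgebraicGeometry.Motives.MumfordTateInvariantsDerivation
import HarnessLib

/-!
# Unipotent one-parameter elements: `exp` of the derivation action (Mumford–Tate invariants, step 3)

For a NILPOTENT `N ∈ End_ℚ(V)` the unipotent automorphism `exp N ∈ GL(V)`
(`unipotentOfNilpotent`) acts on the tensor space `T^{a,b} V` through `exp` of the derivation
action `ρ(N) = tensorDerivation a b N` (`MumfordTateInvariantsDerivation.lean`):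

* `coe_tensorSpaceAct_unipotentOfNilpotent`:
  `(exp N)^{⊗a} ⊗ ((exp N)⁻¹)^{∨ ⊗b} = exp (ρ(N))` — the tensor action of the exponential is the
  exponential of the infinitesimal action (Borel, *Linear Algebraic Groups*, §3.9 and §7.3: in
  characteristic `0` the smallest algebraic subgroup containing `exp(tN)` is the `𝔾ₐ`
  `t ↦ exp(tN)` with Lie algebra `kN`);
* consequently a tensor killed by `ρ(N)` is fixed by `exp N`
  (`tensorSpaceAct_unipotent_eq_self`), and conversely (`apply_eq_zero_of_exp_apply_eq_self`, a
  unit argument: `exp D - 1 = D · u` with `u` unipotent) a tensor fixed by `exp N` is killed by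
  `ρ(N)`; the subspace version (`apply_mem_of_exp_pow_apply_mem`: a subspace stable under `exp D`
  is stable under `D`) goes through the polynomial `m ↦ ℓ(exp(D)ᵐ w)`, which vanishes on `ℕ`.

These are the rational one-parameter unipotent subgroups used to produce RATIONAL points of the
Mumford–Tate group in the proof of `Deligne1982_mumfordTateInvariants` (density of `MT(ℚ)`,
cf. Borel, op. cit., 18.3, here made explicit for unipotent elements).

Also: `exp` of a sum of pairwise commuting nilpotents is the product of the exponentials
(`exp_sum_eq_noncommProd`), `exp` commutes with transposition (`dualMap_exp`).

## References

* A. Borel, *Linear Algebraic Groups*, 2nd ed., GTM 126 (1991), §3.9, §7.3, Thm. 18.2, Cor. 18.3.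
* P. Deligne, *Hodge cycles on abelian varieties*, LNM 900 (1982), I §3.
-/

noncomputable section

open scoped TensorProduct PiTensorProduct

namespace Literature.AlgebraicGeometry.Motives

universe u v w

/-! ### `exp` of sums of commuting nilpotents -/

section ExpSum

variable {A : Type u} [Ring A] [Algebra ℚ A]

/-- The exponential of a nilpotent commutes with whatever the nilpotent commutes with. [folklore] -/
theorem commute_exp_left {x y : A} (h : Commute x y) (hx : IsNilpotent x) :
    Commute (IsNilpotent.exp x) y := by
  obtain ⟨k, hk⟩ := hx
  rw [IsNilpotent.exp_eq_sum hk]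
  exact Commute.sum_left _ _ _ fun i _ => (h.pow_left i).smul_left _

/-- Exponentials of commuting nilpotents commute. [folklore] -/
theorem commute_exp_exp {x y : A} (h : Commute x y) (hx : IsNilpotent x) (hy : IsNilpotent y) :
    Commute (IsNilpotent.exp x) (IsNilpotent.exp y) :=
  (commute_exp_left (commute_exp_left h hx).symm hy).symm

/-- **`exp` of a sum of pairwise commuting nilpotents is the product of the exponentials**
(`IsNilpotent.exp_add_of_commute`, iterated; the product is Mathlib's `Finset.noncommProd`).
[folklore] -/
theorem exp_sum_eq_noncommProd {ι : Type w} (s : Finset ι) (f : ι → A)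
    (hn : ∀ i ∈ s, IsNilpotent (f i)) (hc : ∀ i ∈ s, ∀ j ∈ s, Commute (f i) (f j)) :
    IsNilpotent.exp (∑ i ∈ s, f i) =
      s.noncommProd (fun i => IsNilpotent.exp (f i)) fun i hi j hj _ =>
        commute_exp_exp (hc i hi j hj) (hn i hi) (hn j hj) := by
  classical
  induction s using Finset.induction_on with
  | empty => simp
  | insert i s hi ih =>
    rw [Finset.noncommProd_insert_of_notMem _ _ _ _ hi, Finset.sum_insert hi,
      IsNilpotent.exp_add_of_commute]
    · rw [ih (fun j hj => hn j (Finset.mem_insert_of_mem hj))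
        (fun j hj l hl => hc j (Finset.mem_insert_of_mem hj) l (Finset.mem_insert_of_mem hl))]
    · exact Commute.sum_right _ _ _ fun j hj =>
        hc i (Finset.mem_insert_self i s) j (Finset.mem_insert_of_mem hj)
    · exact hn i (Finset.mem_insert_self i s)
    · exact Commute.isNilpotent_sum (fun j hj => hn j (Finset.mem_insert_of_mem hj))
        fun j l hj hl => hc j (Finset.mem_insert_of_mem hj) l (Finset.mem_insert_of_mem hl)

/-- `exp (m • x) = (exp x)ᵐ` for a nilpotent `x`. [folklore] -/
theorem exp_nsmul {x : A} (hx : IsNilpotent x) (m : ℕ) :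
    IsNilpotent.exp (m • x) = IsNilpotent.exp x ^ m := by
  induction m with
  | zero => simp
  | succ m ih =>
    rw [succ_nsmul, IsNilpotent.exp_add_of_commute ((Commute.refl x).smul_left m) (hx.smul m) hx,
      ih, pow_succ]

/-- **Unit argument**: for a nilpotent `D`, `exp D - 1 = u * D` with `u` a unit (indeed
`u = 1 + (nilpotent)`), so `exp D t = t` forces `D t = 0`. Stated for an endomorphism `D` of a
`ℚ`-vector space. [folklore] -/
theorem apply_eq_zero_of_exp_apply_eq_self {T : Type v} [AddCommGroup T] [Module ℚ T]
    {D : Module.End ℚ T} (hD : IsNilpotent D) {t : T} (ht : IsNilpotent.exp D t = t) : D t = 0 := by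
  obtain ⟨k₀, hk₀⟩ := hD
  -- a bound `k ≥ 2` with `D ^ k = 0`
  set k := max k₀ 2 with hk_def
  have hk : D ^ k = 0 := pow_eq_zero_of_le (le_max_left _ _) hk₀
  have hk2 : 2 ≤ k := le_max_right _ _
  -- `exp D = p(D)` for the truncated exponential polynomial `p`
  set p : Polynomial ℚ := ∑ i ∈ Finset.range k, Polynomial.C ((i.factorial : ℚ)⁻¹) *
    Polynomial.X ^ i with hp_def
  have hexp : IsNilpotent.exp D = Polynomial.aeval D p := by
    rw [IsNilpotent.exp_eq_sum hk, hp_def, map_sum]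
    refine Finset.sum_congr rfl fun i _ => ?_
    rw [map_mul, Polynomial.aeval_C, Polynomial.aeval_X_pow, Algebra.algebraMap_eq_smul_one,
      smul_mul_assoc, one_mul]
  have hp0 : p.coeff 0 = 1 := by
    rw [hp_def, Polynomial.finsetSum_coeff]
    rw [Finset.sum_eq_single 0]
    · simp
    · intro i _ hi
      simp [Polynomial.coeff_X_pow, Ne.symm hi]
    · intro h
      exact absurd (Finset.mem_range.2 (by omega)) h
  have hp1 : p.coeff 1 = 1 := by
    rw [hp_def, Polynomial.finsetSum_coeff]
    rw [Finset.sum_eq_single 1]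
    · simp
    · intro i _ hi
      simp [Polynomial.coeff_X_pow, Ne.symm hi]
    · intro h
      exact absurd (Finset.mem_range.2 (by omega)) h
  -- `p = q X + 1`, `q = r X + 1`
  set q := Polynomial.divX p with hq_def
  set r := Polynomial.divX q with hr_def
  have hpq : p = q * Polynomial.X + 1 := by
    conv_lhs => rw [← Polynomial.divX_mul_X_add p, hp0, map_one]
  have hqr : q = r * Polynomial.X + 1 := by
    conv_lhs => rw [← Polynomial.divX_mul_X_add q]
    rw [hq_def, Polynomial.coeff_divX, zero_add, hp1, map_one]
  -- `q(D)` is a unit: `1 + r(D) D` with `r(D) D` nilpotent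
  have hcomm : Commute (Polynomial.aeval D r) D := by
    have h := congrArg (Polynomial.aeval D) (mul_comm r Polynomial.X)
    simp only [map_mul, Polynomial.aeval_X] at h
    exact h
  have hunit : IsUnit (Polynomial.aeval D q) := by
    rw [hqr, map_add, map_mul, Polynomial.aeval_X, map_one, add_comm]
    exact IsNilpotent.isUnit_one_add (hcomm.isNilpotent_mul_left ⟨k, hk⟩)
  -- `(exp D - 1) t = 0` gives `q(D) (D t) = 0`
  have h1 : Polynomial.aeval D q (D t) = 0 := by
    have : (IsNilpotent.exp D - 1) t = 0 := by simp [ht]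
    rwa [hexp, hpq, map_add, map_one, add_sub_cancel_right, map_mul, Polynomial.aeval_X,
      Module.End.mul_apply] at this
  obtain ⟨uq, huq⟩ := hunit
  have h2 := congrArg (↑uq⁻¹ : Module.End ℚ T) h1
  rwa [map_zero, ← huq, ← Module.End.mul_apply, Units.inv_mul, Module.End.one_apply] at h2

/-- **Polynomial argument, subspace version**: if `D` is nilpotent and all powers `(exp D)ᵐ w`,
`m ∈ ℕ`, lie in a subspace `W`, then `D w ∈ W`. Proof: for a linear form `ℓ` vanishing on `W`,
`m ↦ ℓ((exp D)ᵐ w) = ℓ(exp(mD) w) = Σᵢ mⁱ ℓ(Dⁱ w)/i!` is a polynomial in `m` vanishing on `ℕ`,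
hence zero, so `ℓ(D w) = 0`; conclude by the double annihilator. [folklore] -/
theorem apply_mem_of_exp_pow_apply_mem {T : Type v} [AddCommGroup T] [Module ℚ T]
    {D : Module.End ℚ T} (hD : IsNilpotent D) (W : Submodule ℚ T) {w : T}
    (h : ∀ m : ℕ, (IsNilpotent.exp D ^ m) w ∈ W) : D w ∈ W := by
  obtain ⟨k₀, hk₀⟩ := hD
  set k := max k₀ 2 with hk_def
  have hk : D ^ k = 0 := pow_eq_zero_of_le (le_max_left _ _) hk₀
  have hk2 : 2 ≤ k := le_max_right _ _
  rw [← Subspace.dualAnnihilator_dualCoannihilator_eq (W := W), Submodule.mem_dualCoannihilator]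
  intro ℓ hℓ
  rw [Submodule.mem_dualAnnihilator] at hℓ
  set P : Polynomial ℚ := ∑ i ∈ Finset.range k,
    Polynomial.C ((i.factorial : ℚ)⁻¹ * ℓ ((D ^ i) w)) * Polynomial.X ^ i with hP_def
  have hP : ∀ m : ℕ, P.eval (m : ℚ) = ℓ ((IsNilpotent.exp D ^ m) w) := by
    intro m
    have hmk : ((m : ℚ) • D) ^ k = 0 := by rw [smul_pow, hk, smul_zero]
    rw [← exp_nsmul ⟨k, hk⟩ m, ← Nat.cast_smul_eq_nsmul ℚ, IsNilpotent.exp_eq_sum hmk, hP_def,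
      Polynomial.eval_finsetSum]
    simp only [LinearMap.sum_apply, map_sum, LinearMap.smul_apply, map_smul, smul_pow,
      Polynomial.eval_mul, Polynomial.eval_C, Polynomial.eval_pow, Polynomial.eval_X, smul_eq_mul]
    exact Finset.sum_congr rfl fun i _ => by ring
  have hroots : Set.Infinite {x : ℚ | P.IsRoot x} := by
    refine Set.infinite_of_injective_forall_mem Nat.cast_injective fun m => ?_
    change P.IsRoot (m : ℚ)
    rw [Polynomial.IsRoot, hP m]
    exact hℓ _ (h m)
  have hP0 : P = 0 := Polynomial.eq_zero_of_infinite_isRoot P hroots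
  have hc1 : P.coeff 1 = ℓ (D w) := by
    rw [hP_def, Polynomial.finsetSum_coeff, Finset.sum_eq_single 1]
    · rw [Polynomial.coeff_C_mul_X_pow, if_pos rfl]
      simp
    · intro i _ hi
      rw [Polynomial.coeff_C_mul_X_pow, if_neg (Ne.symm hi)]
    · intro h'
      exact absurd (Finset.mem_range.2 (by omega)) h'
  rw [← hc1, hP0, Polynomial.coeff_zero]

end ExpSum

/-! ### `exp` of the derivation action and the unipotent automorphism `exp N` -/

section Rational

variable {V : Type v} [AddCommGroup V] [Module ℚ V]

/-- `exp` commutes with transposition: `(exp N)^∨ = exp (N^∨)`. [folklore] -/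
theorem dualMap_exp {N : Module.End ℚ V} (hN : IsNilpotent N) :
    (IsNilpotent.exp N).dualMap =
      IsNilpotent.exp (N.dualMap : Module.End ℚ (Module.Dual ℚ V)) := by
  obtain ⟨k, hk⟩ := hN
  have hk' : (N.dualMap : Module.End ℚ (Module.Dual ℚ V)) ^ k = 0 := by
    rw [← dualMap_pow, hk]
    exact map_zero (Module.Dual.transpose (R := ℚ))
  rw [IsNilpotent.exp_eq_sum hk, IsNilpotent.exp_eq_sum hk', LinearMap.dualMap_def, map_sum]
  refine Finset.sum_congr rfl fun i _ => ?_
  rw [map_smul, ← LinearMap.dualMap_def, dualMap_pow]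

/-- `exp` commutes with `f ↦ f ⊗ 1`: `(exp D) ⊗ 1 = exp (D ⊗ 1)`. [folklore] -/
theorem rTensor_exp {M : Type u} {N : Type w} [AddCommGroup M] [Module ℚ M] [AddCommGroup N]
    [Module ℚ N] {D : Module.End ℚ M} (hD : IsNilpotent D) :
    (IsNilpotent.exp D).rTensor N = IsNilpotent.exp (D.rTensor N) := by
  obtain ⟨k, hk⟩ := hD
  have hk' : D.rTensor N ^ k = 0 := by rw [LinearMap.rTensor_pow, hk, LinearMap.rTensor_zero]
  rw [IsNilpotent.exp_eq_sum hk, IsNilpotent.exp_eq_sum hk']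
  change LinearMap.rTensorHom N _ = _
  rw [map_sum]
  refine Finset.sum_congr rfl fun i _ => ?_
  rw [map_smul, LinearMap.rTensor_pow]
  rfl

/-- `exp` commutes with `f ↦ 1 ⊗ f`: `1 ⊗ (exp D) = exp (1 ⊗ D)`. [folklore] -/
theorem lTensor_exp {M : Type u} {N : Type w} [AddCommGroup M] [Module ℚ M] [AddCommGroup N]
    [Module ℚ N] {D : Module.End ℚ M} (hD : IsNilpotent D) :
    (IsNilpotent.exp D).lTensor N = IsNilpotent.exp (D.lTensor N) := by
  obtain ⟨k, hk⟩ := hD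
  have hk' : D.lTensor N ^ k = 0 := by rw [LinearMap.lTensor_pow, hk, LinearMap.lTensor_zero]
  rw [IsNilpotent.exp_eq_sum hk, IsNilpotent.exp_eq_sum hk']
  change LinearMap.lTensorHom N _ = _
  rw [map_sum]
  refine Finset.sum_congr rfl fun i _ => ?_
  rw [map_smul, LinearMap.lTensor_pow]
  rfl

/-- `exp` of the derivation `Σₖ (⋯ ⊗ N ⊗ ⋯)` on `V^{⊗a}` is `(exp N)^{⊗a}`. [folklore] -/
theorem exp_piTensorDerivation (a : ℕ) {N : Module.End ℚ V} (hN : IsNilpotent N) :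
    IsNilpotent.exp (piTensorDerivation a N) =
      PiTensorProduct.map fun _ : Fin a => IsNilpotent.exp N := by
  have hcomm : ∀ k ∈ (Finset.univ : Finset (Fin a)), ∀ l ∈ (Finset.univ : Finset (Fin a)),
      Commute (piTensorSlot a k N) (piTensorSlot a l N) := by
    intro k _ l _
    by_cases hkl : k = l
    · subst hkl
      exact Commute.refl _
    · exact commute_piTensorSlot a hkl N N
  rw [piTensorDerivation_apply,
    exp_sum_eq_noncommProd _ _ (fun k _ => hN.map (piTensorSlot a k)) hcomm,
    Finset.noncommProd_congr rfl (fun k _ => (IsNilpotent.map_exp hN (piTensorSlot a k)).symm),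
    noncommProd_piTensorSlot]

/-- **`exp` of the derivation action on `T^{a,b}` is the tensor action of `exp N`**:
`exp (ρ(N)) = (exp N)^{⊗a} ⊗ (exp (-N^∨))^{⊗b}` (Borel, *Linear Algebraic Groups*, §3.9: the
representation of `exp(tN)` on tensors is the exponential of the derivation). [folklore] -/
theorem exp_tensorDerivation (a b : ℕ) {N : Module.End ℚ V} (hN : IsNilpotent N) :
    IsNilpotent.exp (tensorDerivation a b N) =
      TensorProduct.map (PiTensorProduct.map fun _ : Fin a => IsNilpotent.exp N)
        (PiTensorProduct.map fun _ : Fin b =>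
          IsNilpotent.exp (-(N.dualMap : Module.End ℚ (Module.Dual ℚ V)))) := by
  let A : Module.End ℚ (hodgeTensorSpace V a b) :=
    LinearMap.rTensor (⨂[ℚ]^b (Module.Dual ℚ V)) (piTensorDerivation a N)
  let B : Module.End ℚ (hodgeTensorSpace V a b) := LinearMap.lTensor (⨂[ℚ]^a V)
    (piTensorDerivation b (-(N.dualMap : Module.End ℚ (Module.Dual ℚ V))))
  have hAB : tensorDerivation a b N = A + B := by
    change _ = _ + LinearMap.lTensor (⨂[ℚ]^a V)
      (piTensorDerivation b (-(N.dualMap : Module.End ℚ (Module.Dual ℚ V))))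
    rw [map_neg, LinearMap.lTensor_neg]
    exact sub_eq_add_neg (G := Module.End ℚ (hodgeTensorSpace V a b)) _ _
  have hA : IsNilpotent A :=
    (isNilpotent_piTensorDerivation a hN).map
      (Module.End.rTensorAlgHom ℚ (⨂[ℚ]^a V) (⨂[ℚ]^b (Module.Dual ℚ V))).toRingHom
  have hB : IsNilpotent B :=
    (isNilpotent_piTensorDerivation b (isNilpotent_dualMap hN).neg).map
      (Module.End.lTensorAlgHom ℚ (⨂[ℚ]^b (Module.Dual ℚ V)) (⨂[ℚ]^a V)).toRingHom
  have hcomm : Commute A B := by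
    change _ ∘ₗ _ = _ ∘ₗ _
    exact (LinearMap.rTensor_comp_lTensor _ _ _).trans (LinearMap.lTensor_comp_rTensor _ _ _).symm
  have eA : IsNilpotent.exp A =
      LinearMap.rTensor (⨂[ℚ]^b (Module.Dual ℚ V))
        (PiTensorProduct.map fun _ : Fin a => IsNilpotent.exp N) := by
    rw [← exp_piTensorDerivation a hN]
    exact (rTensor_exp (isNilpotent_piTensorDerivation a hN)).symm
  have eB : IsNilpotent.exp B =
      LinearMap.lTensor (⨂[ℚ]^a V) (PiTensorProduct.map fun _ : Fin b =>
        IsNilpotent.exp (-(N.dualMap : Module.End ℚ (Module.Dual ℚ V)))) := by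
    rw [← exp_piTensorDerivation b (isNilpotent_dualMap hN).neg]
    exact (lTensor_exp (isNilpotent_piTensorDerivation b (isNilpotent_dualMap hN).neg)).symm
  rw [hAB, IsNilpotent.exp_add_of_commute hcomm hA hB, eA, eB, Module.End.mul_eq_comp]
  exact LinearMap.rTensor_comp_lTensor _ _ _

/-- The **unipotent automorphism** `exp N ∈ GL(V)` of a nilpotent `N ∈ End_ℚ(V)`, with inverse
`exp (-N)` (Borel, *Linear Algebraic Groups*, §7.3: the `𝔾ₐ` through a nilpotent element).
[folklore] -/
def unipotentOfNilpotent {N : Module.End ℚ V} (hN : IsNilpotent N) : V ≃ₗ[ℚ] V :=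
  LinearEquiv.ofLinear (IsNilpotent.exp N) (IsNilpotent.exp (-N))
    (by rw [← Module.End.mul_eq_comp]; exact IsNilpotent.exp_mul_exp_neg_self hN)
    (by rw [← Module.End.mul_eq_comp]; exact IsNilpotent.exp_neg_mul_exp_self hN)

/-- The underlying linear map of `unipotentOfNilpotent hN` is `exp N`. [folklore] -/
theorem coe_unipotentOfNilpotent {N : Module.End ℚ V} (hN : IsNilpotent N) :
    (unipotentOfNilpotent hN : V →ₗ[ℚ] V) = IsNilpotent.exp N :=
  rfl

/-- The inverse of `unipotentOfNilpotent hN` is `exp (-N)`. [folklore] -/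
theorem coe_unipotentOfNilpotent_symm {N : Module.End ℚ V} (hN : IsNilpotent N) :
    ((unipotentOfNilpotent hN).symm : V →ₗ[ℚ] V) = IsNilpotent.exp (-N) :=
  rfl

/-- **The tensor action of `exp N` is `exp` of the derivation action of `N`**:
`(exp N)^{⊗a} ⊗ (((exp N)⁻¹)^∨)^{⊗b} = exp (ρ(N))` on `T^{a,b} V` (Borel, *Linear Algebraic
Groups*, §3.9; Deligne, LNM 900, I §3.1 for the action). [folklore] -/
theorem coe_tensorSpaceAct_unipotentOfNilpotent (a b : ℕ) {N : Module.End ℚ V} (hN : IsNilpotent N) :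
    ((tensorSpaceAct (a := a) (b := b) (unipotentOfNilpotent hN) :
        hodgeTensorSpace V a b ≃ₗ[ℚ] hodgeTensorSpace V a b) :
        hodgeTensorSpace V a b →ₗ[ℚ] hodgeTensorSpace V a b) =
      IsNilpotent.exp (tensorDerivation a b N) := by
  have hdual : ((unipotentOfNilpotent hN).symm.dualMap :
      Module.Dual ℚ V →ₗ[ℚ] Module.Dual ℚ V) =
      IsNilpotent.exp (-(N.dualMap : Module.End ℚ (Module.Dual ℚ V))) := by
    change (IsNilpotent.exp (-N)).dualMap = _
    rw [dualMap_exp hN.neg, LinearMap.dualMap_def, map_neg]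
    rfl
  rw [coe_tensorSpaceAct, exp_tensorDerivation a b hN, hdual]
  rfl

/-- A tensor killed by the derivation action of a nilpotent `N` is fixed by `exp N`
(`exp ρ(N) t = t + ρ(N)(⋯) = t`). [folklore] -/
theorem tensorSpaceAct_unipotent_eq_self {a b : ℕ} {N : Module.End ℚ V} (hN : IsNilpotent N)
    {t : hodgeTensorSpace V a b} (ht : tensorDerivation a b N t = 0) :
    tensorSpaceAct (unipotentOfNilpotent hN) t = t := by
  have h := LinearMap.congr_fun (coe_tensorSpaceAct_unipotentOfNilpotent a b hN) t
  rw [LinearEquiv.coe_coe] at h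
  rw [h]
  obtain ⟨k, hk⟩ := isNilpotent_tensorDerivation a b hN
  have hk' : tensorDerivation a b N ^ (k + 1) = 0 := by rw [pow_succ, hk, zero_mul]
  rw [IsNilpotent.exp_eq_sum hk', LinearMap.sum_apply, Finset.sum_eq_single 0]
  · simp
  · intro i _ hi
    obtain ⟨j, rfl⟩ := Nat.exists_eq_succ_of_ne_zero hi
    rw [LinearMap.smul_apply, pow_succ, Module.End.mul_apply, ht, map_zero, smul_zero]
  · intro h'
    exact absurd (Finset.mem_range.2 (Nat.succ_pos k)) h'

/-- **A tensor fixed by the unipotent `exp N` is killed by the derivation action of `N`**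
(the unit argument `apply_eq_zero_of_exp_apply_eq_self`). [folklore] -/
theorem tensorDerivation_apply_eq_zero_of_fixed {a b : ℕ} {N : Module.End ℚ V} (hN : IsNilpotent N)
    {t : hodgeTensorSpace V a b} (ht : tensorSpaceAct (unipotentOfNilpotent hN) t = t) :
    tensorDerivation a b N t = 0 := by
  refine apply_eq_zero_of_exp_apply_eq_self (isNilpotent_tensorDerivation a b hN) ?_
  have h := LinearMap.congr_fun (coe_tensorSpaceAct_unipotentOfNilpotent a b hN) t
  rw [LinearEquiv.coe_coe] at h
  rw [← h, ht]

/-- **A subspace stable under the unipotent `exp N` is stable under the derivation action of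
`N`** (polynomial argument `apply_mem_of_exp_pow_apply_mem` applied to the powers `(exp N)ᵐ`,
which all stabilise the subspace). [folklore] -/
theorem tensorDerivation_apply_mem_of_stable {a b : ℕ} {N : Module.End ℚ V} (hN : IsNilpotent N)
    (W : Submodule ℚ (hodgeTensorSpace V a b))
    (hW : ∀ w ∈ W, tensorSpaceAct (unipotentOfNilpotent hN) w ∈ W) {w : hodgeTensorSpace V a b}
    (hw : w ∈ W) : tensorDerivation a b N w ∈ W := by
  refine apply_mem_of_exp_pow_apply_mem (isNilpotent_tensorDerivation a b hN) W fun m => ?_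
  rw [← coe_tensorSpaceAct_unipotentOfNilpotent]
  induction m with
  | zero => simpa using hw
  | succ m ih =>
    rw [pow_succ', Module.End.mul_apply]
    exact hW _ ih

end Rational

end Literature.AlgebraicGeometry.Motives

end
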